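import Summits.CriticalPhenomena.PercolationContinuityZ3.Theorems.PercNearOneGluingNoHeavyLowerTailSunflowerSafeCalculus
import HarnessLib

/-!
# `NoHeavyLowerTail` (crux stmt-CriticalPhenomena-4575), abstract sunflower cubic: THE CORE `C₅⁽³⁾` IS NOT A-SAFE

Support file (seat `prim-ineq-prove-1` gen 39; `--supports stmt-CriticalPhenomena-4575`).  No `sorry`, no named facts.  Memo:
run/shared/lean/prim/prim-ineq-prove-1/FINDING-GRAPHCORES-prove1-g39.md §4.

`C₅⁽³⁾` = the up-set of `Set (Fin 5)` generated by the five 3-intervals `{i, i+1, i+2}` of the 5-cycle ("three consecutive open points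
on a pentagon"; census name `123,124,135,245,345`).  By the exact census it is, together with `maj₃` and the fans `F₄, F₅`, one of the
four minor-minimal non-A-safe cores on at most 5 points (memo §4).  THEOREM `not_aSafe_pentagonCubed`: `∃ p, ¬ Safe p pentagonCubed`.
Witness: uniform `p = 1/50` and the five PRINCIPAL petals `{j ∈ ω ∧ j+1 ∈ ω}` (any two consecutive pairs of the pentagon together
contain a 3-interval, so the petals meet pairwise inside the core): `∏ μ(petal) = p^{10}` while `μ(core) ≤ 5p³` and `(5p³)⁴ < p^{10}`
for `p < 1/25`.
-/

noncomputable section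

namespace Summit.CriticalPhenomena.PercolationContinuityZ3.Theorems.SunflowerPartition

namespace SafeCalc

open MeasureTheory Finset
open Literature.Probability.LatticeModels Literature.Probability.Percolation

/-- The five 3-intervals of the pentagon. [this work] -/
def pentInterval : Fin 5 → Finset (Fin 5) := ![{0, 1, 2}, {1, 2, 3}, {2, 3, 4}, {3, 4, 0}, {4, 0, 1}]

/-- The five consecutive pairs (edges) of the pentagon. [this work] -/
def pentEdge : Fin 5 → Finset (Fin 5) := ![{0, 1}, {1, 2}, {2, 3}, {3, 4}, {4, 0}]

/-- The core `C₅⁽³⁾`: some 3-interval of the pentagon is open. [this work] -/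
def pentagonCubed : Set (Set (Fin 5)) := {ω | ∃ i, (↑(pentInterval i) : Set (Fin 5)) ⊆ ω}

/-- `C₅⁽³⁾` is an up-set. [this work] -/
theorem isUpperSet_pentagonCubed : IsUpperSet pentagonCubed := by
  rintro ω ω' hle ⟨i, hi⟩
  exact ⟨i, hi.trans hle⟩

/-- Any two distinct edges of the pentagon together contain a 3-interval. [this work] -/
theorem pentEdge_union : ∀ i j : Fin 5, i ≠ j → ∃ k, pentInterval k ⊆ pentEdge i ∪ pentEdge j := by decide

/-- The edges have two points, the intervals three. [this work] -/
theorem card_pentEdge : ∀ i : Fin 5, (pentEdge i).card = 2 := by decide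

/-- The intervals have three points. [this work] -/
theorem card_pentInterval : ∀ i : Fin 5, (pentInterval i).card = 3 := by decide

/-- **`C₅⁽³⁾` is not A-safe.** [this work] -/
theorem not_aSafe_pentagonCubed : ∃ p : Fin 5 → unitInterval, ¬ Safe p pentagonCubed := by
  classical
  refine ⟨fun _ => ⟨1 / 50, by norm_num⟩, fun hsafe => ?_⟩
  set p : Fin 5 → unitInterval := fun _ => ⟨1 / 50, by norm_num⟩ with hp
  have hpv : ∀ i, (p i : ℝ) = 1 / 50 := fun i => rfl
  -- the five principal petals
  let V : Fin 5 → Set (Set (Fin 5)) := fun j => {ω | (↑(pentEdge j) : Set (Fin 5)) ⊆ ω}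
  have hV : ∀ j, IsUpperSet (V j) := fun j ω ω' hle hω => (show (↑(pentEdge j) : Set (Fin 5)) ⊆ ω from hω).trans hle
  have hcap : ∀ i j, i ≠ j → V i ∩ V j ⊆ pentagonCubed := by
    intro i j hij ω hω
    obtain ⟨k, hk⟩ := pentEdge_union i j hij
    refine ⟨k, fun x hx => ?_⟩
    have hx' : x ∈ pentEdge i ∪ pentEdge j := hk (Finset.mem_coe.1 hx)
    rcases Finset.mem_union.1 hx' with h | h
    · exact hω.1 (Finset.mem_coe.2 h)
    · exact hω.2 (Finset.mem_coe.2 h)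
  have key := hsafe 5 V hV hcap
  have hVj : ∀ j, (prodBernoulli p).real (V j) = (1 / 50) ^ 2 := by
    intro j
    show (prodBernoulli p).real {ω | (↑(pentEdge j) : Set (Fin 5)) ⊆ ω} = _
    rw [prodBernoulli_real_subset, Finset.prod_congr rfl fun i _ => hpv i, Finset.prod_const, card_pentEdge]
  rw [Finset.prod_congr rfl fun j _ => hVj j, Finset.prod_const, Finset.card_univ, Fintype.card_fin] at key
  -- upper bound for the core: union bound over the five intervals
  have hsub : pentagonCubed ⊆ ⋃ i ∈ (univ : Finset (Fin 5)), {ω | (↑(pentInterval i) : Set (Fin 5)) ⊆ ω} := by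
    rintro ω ⟨i, hi⟩
    exact Set.mem_biUnion (Finset.mem_coe.2 (Finset.mem_univ i)) hi
  have hI : ∀ i, (prodBernoulli p).real {ω | (↑(pentInterval i) : Set (Fin 5)) ⊆ ω} = (1 / 50) ^ 3 := by
    intro i
    rw [prodBernoulli_real_subset, Finset.prod_congr rfl fun i _ => hpv i, Finset.prod_const, card_pentInterval]
  have hA : (prodBernoulli p).real pentagonCubed ≤ 5 * (1 / 50) ^ 3 := by
    calc (prodBernoulli p).real pentagonCubed
        ≤ (prodBernoulli p).real (⋃ i ∈ (univ : Finset (Fin 5)), {ω | (↑(pentInterval i) : Set (Fin 5)) ⊆ ω}) :=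
          measureReal_mono hsub (measure_ne_top _ _)
      _ ≤ ∑ i ∈ (univ : Finset (Fin 5)), (prodBernoulli p).real {ω | (↑(pentInterval i) : Set (Fin 5)) ⊆ ω} :=
          measureReal_biUnion_finset_le _ _
      _ = 5 * (1 / 50) ^ 3 := by
          rw [Finset.sum_congr rfl fun i _ => hI i, Finset.sum_const, Finset.card_univ, Fintype.card_fin]; simp
  have hA0 : 0 ≤ (prodBernoulli p).real pentagonCubed := measureReal_nonneg
  have h1 : (((1 : ℝ) / 50) ^ 2) ^ 5 ≤ (5 * ((1 : ℝ) / 50) ^ 3) ^ (5 - 1) :=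
    key.trans (pow_le_pow_left₀ hA0 hA _)
  norm_num at h1

end SafeCalc

end Summit.CriticalPhenomena.PercolationContinuityZ3.Theorems.SunflowerPartition
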